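import Summits.AtomisticToContinuum.BoseEinsteinCondensation.Theorems.BECThomsonPrincipleGDTransferLnssAlgebraOps

/-!
# Route `BECThomsonPrinciple`, crux `GDTransfer` (stmt-AtomisticToContinuum-9482), line `dyson-dressed-witness`:
# stub `lnssAlgebra`, part 1b — `Q_S` is self-adjoint; orthogonality and Pythagoras

Support file of `stub_lnssAlgebra`, continuing part 1a (`…LnssAlgebraOps`).  On continuous functions each
factor `P_a` / `1 - P_a` of the crux's `foldr` is self-adjoint in `L²(cell^N)` (`Negative.integral_conj_mul_cellAvg`),
hence so is `Q_S` (`integral_conj_mul_modeProj`: the adjoint of the `foldr` is the `foldr` over the reversed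
list, which is the same operator by `foldr_perm`); the `Q_S g`, `S` ranging over subsets, are pairwise
orthogonal (`integral_conj_modeProj_mul_modeProj`) and satisfy Pythagoras
`∫|Σ_S c_S Q_S g|² = Σ_S |c_S|² ∫|Q_S g|²` (`integral_norm_sq_sum_modeProj`), in particular
`Σ_S ∫|Q_S g|² = ∫|g|²`.  Partly adapted from the (private) toolkit of
`BECThomsonPrincipleGaussianDominationCanThetaNorm.lean`.  All [folklore] (LSSY2005 App. A).
-/

noncomputable section

open MeasureTheory Filter
open scoped ENNReal NNReal ComplexConjugate

namespace Summit.AtomisticToContinuum.BoseEinsteinCondensation.Cruxes.GDTransfer.DysonDressedWitness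

namespace Lnss

open Literature.MathematicalPhysics.QuantumManyBody.BoseGas
open Summit.AtomisticToContinuum.BoseEinsteinCondensation.Theorems.GaussianDominationCan.Negative
open ChordVariation (continuous_foldr_cellAvg continuous_modeProj)

variable {N m : ℕ} {L : ℝ}

/-! ## Self-adjointness of `Q_S`, orthogonality, Pythagoras -/

/-- One factor `P_a` / `1 - P_a` is continuous on continuous functions. [folklore] -/
theorem continuous_step (S : Finset (Fin N)) (a : Fin N) {f : Config N → ℂ} (hf : Continuous f) :
    Continuous (if a ∈ S then cellAvg N L a f else f - cellAvg N L a f) := by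
  split_ifs
  · exact continuous_cellAvg a hf
  · exact hf.sub (continuous_cellAvg a hf)

/-- One factor `P_a` / `1 - P_a` is self-adjoint on continuous functions. [folklore] -/
theorem integral_conj_mul_step {n : ℕ} (S : Finset (Fin (n + 1))) (a : Fin (n + 1))
    {f g : Config (n + 1) → ℂ} (hf : Continuous f) (hg : Continuous g) :
    ∫ X in cellN (n + 1) L, conj (f X) *
        (if a ∈ S then cellAvg (n + 1) L a g else g - cellAvg (n + 1) L a g) X =
      ∫ X in cellN (n + 1) L,
        conj ((if a ∈ S then cellAvg (n + 1) L a f else f - cellAvg (n + 1) L a f) X) * g X := by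
  by_cases haS : a ∈ S
  · simp only [if_pos haS]
    exact integral_conj_mul_cellAvg a hf hg
  · simp only [if_neg haS, Pi.sub_apply, map_sub, mul_sub, sub_mul]
    have hcf : Continuous fun X => conj (f X) := Complex.continuous_conj.comp hf
    have h1 : IntegrableOn (fun X => conj (f X) * g X) (cellN (n + 1) L) volume :=
      integrableOn_cellN (hcf.mul hg) L
    have h2 : IntegrableOn (fun X => conj (f X) * cellAvg (n + 1) L a g X) (cellN (n + 1) L) volume :=
      integrableOn_cellN (hcf.mul (continuous_cellAvg a hg)) L
    have h3 : IntegrableOn (fun X => conj (cellAvg (n + 1) L a f X) * g X) (cellN (n + 1) L) volume :=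
      integrableOn_cellN ((Complex.continuous_conj.comp (continuous_cellAvg a hf)).mul hg) L
    rw [integral_sub h1 h2, integral_sub h1 h3, integral_conj_mul_cellAvg a hf hg]

/-- The `foldr` is self-adjoint up to reversing its list. [folklore] -/
theorem integral_conj_mul_foldr {n : ℕ} (S : Finset (Fin (n + 1))) (l : List (Fin (n + 1)))
    {f g : Config (n + 1) → ℂ} (hf : Continuous f) (hg : Continuous g) :
    ∫ X in cellN (n + 1) L, conj (f X) *
        l.foldr (fun i h => if i ∈ S then cellAvg (n + 1) L i h else h - cellAvg (n + 1) L i h)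
          g X =
      ∫ X in cellN (n + 1) L, conj (l.reverse.foldr
        (fun i h => if i ∈ S then cellAvg (n + 1) L i h else h - cellAvg (n + 1) L i h) f X) *
          g X := by
  induction l generalizing f with
  | nil => rfl
  | cons a l ih =>
    rw [List.foldr_cons, List.reverse_cons, List.foldr_append, List.foldr_cons, List.foldr_nil,
      integral_conj_mul_step S a hf (continuous_foldr_cellAvg S l hg)]
    exact ih (continuous_step S a hf)

/-- **`Q_S` is self-adjoint** on continuous functions: `∫ conj(f) Q_S g = ∫ conj(Q_S f) g`.
[folklore] -/
theorem integral_conj_mul_modeProj {n : ℕ} (S : Finset (Fin (n + 1)))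
    {f g : Config (n + 1) → ℂ} (hf : Continuous f) (hg : Continuous g) :
    ∫ X in cellN (n + 1) L, conj (f X) * modeProj (n + 1) L S g X =
      ∫ X in cellN (n + 1) L, conj (modeProj (n + 1) L S f X) * g X := by
  unfold modeProj
  rw [integral_conj_mul_foldr S _ hf hg, foldr_perm S (List.reverse_perm _) hf]

/-- **Orthogonality** of `Q_S g`, `Q_T g` for `S ≠ T` in `L²(cell^N)`. [folklore] -/
theorem integral_conj_modeProj_mul_modeProj {n : ℕ} (hL : 0 < L)
    {S T : Finset (Fin (n + 1))} (hST : S ≠ T) {g : Config (n + 1) → ℂ} (hg : Continuous g) :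
    ∫ X in cellN (n + 1) L, conj (modeProj (n + 1) L S g X) * modeProj (n + 1) L T g X = 0 := by
  -- adapted from `BECThomsonPrincipleGaussianDominationCanThetaNorm`
  obtain ⟨i, hi⟩ : ∃ i, ¬(i ∈ S ↔ i ∈ T) := not_forall.1 fun h => hST (Finset.ext h)
  have hS := continuous_modeProj (L := L) S hg
  have hT := continuous_modeProj (L := L) T hg
  have h1 := cellAvg_modeProj hL S i hg
  have h2 := cellAvg_modeProj hL T i hg
  by_cases hiS : i ∈ S
  · have hiT : i ∉ T := fun h => hi (iff_of_true hiS h)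
    rw [if_pos hiS] at h1; rw [if_neg hiT] at h2
    calc ∫ X in cellN (n + 1) L, conj (modeProj (n + 1) L S g X) * modeProj (n + 1) L T g X
        = ∫ X in cellN (n + 1) L, conj (cellAvg (n + 1) L i (modeProj (n + 1) L S g) X) *
            modeProj (n + 1) L T g X := by rw [h1]
      _ = ∫ X in cellN (n + 1) L, conj (modeProj (n + 1) L S g X) *
            cellAvg (n + 1) L i (modeProj (n + 1) L T g) X :=
          (integral_conj_mul_cellAvg i hS hT).symm
      _ = 0 := by simp [h2]
  · have hiT : i ∈ T := of_not_not fun h => hi (iff_of_false hiS h)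
    rw [if_neg hiS] at h1; rw [if_pos hiT] at h2
    calc ∫ X in cellN (n + 1) L, conj (modeProj (n + 1) L S g X) * modeProj (n + 1) L T g X
        = ∫ X in cellN (n + 1) L, conj (modeProj (n + 1) L S g X) *
            cellAvg (n + 1) L i (modeProj (n + 1) L T g) X := by rw [h2]
      _ = ∫ X in cellN (n + 1) L, conj (cellAvg (n + 1) L i (modeProj (n + 1) L S g) X) *
            modeProj (n + 1) L T g X := integral_conj_mul_cellAvg i hS hT
      _ = 0 := by simp [h1]

/-- `∫ conj(φ) φ = ∫ |φ|²` as a complex number. [folklore] -/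
theorem integral_conj_mul_self (φ : Config N → ℂ) :
    ∫ X in cellN N L, conj (φ X) * φ X = ((∫ X in cellN N L, ‖φ X‖ ^ 2 : ℝ) : ℂ) := by
  simp_rw [Complex.conj_mul', ← Complex.ofReal_pow]
  exact integral_ofReal

/-- **Pythagoras** for the orthogonal family `Q_S g`:
`∫ |Σ_{S∈𝒯} c_S Q_S g|² = Σ_{S∈𝒯} |c_S|² ∫ |Q_S g|²`. [folklore] -/
theorem integral_norm_sq_sum_modeProj {n : ℕ} (hL : 0 < L)
    (𝒯 : Finset (Finset (Fin (n + 1)))) (c : Finset (Fin (n + 1)) → ℂ) {g : Config (n + 1) → ℂ}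
    (hg : Continuous g) :
    ∫ X in cellN (n + 1) L, ‖∑ S ∈ 𝒯, c S * modeProj (n + 1) L S g X‖ ^ 2 =
      ∑ S ∈ 𝒯, ‖c S‖ ^ 2 * ∫ X in cellN (n + 1) L, ‖modeProj (n + 1) L S g X‖ ^ 2 := by
  -- adapted from `BECThomsonPrincipleGaussianDominationCanThetaNorm`
  have hQ : ∀ S, Continuous (modeProj (n + 1) L S g) := fun S => continuous_modeProj S hg
  have hint : ∀ S T, Integrable (fun X => conj (c S) * c T *
      (conj (modeProj (n + 1) L S g X) * modeProj (n + 1) L T g X))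
      ((volume : Measure (Config (n + 1))).restrict (cellN (n + 1) L)) := fun S T =>
    integrableOn_cellN (continuous_const.mul
      ((Complex.continuous_conj.comp (hQ S)).mul (hQ T))) L
  apply Complex.ofReal_injective
  calc ((∫ X in cellN (n + 1) L, ‖∑ S ∈ 𝒯, c S * modeProj (n + 1) L S g X‖ ^ 2 : ℝ) : ℂ)
      = ∫ X in cellN (n + 1) L, conj (∑ S ∈ 𝒯, c S * modeProj (n + 1) L S g X) *
          ∑ S ∈ 𝒯, c S * modeProj (n + 1) L S g X := (integral_conj_mul_self _).symm
    _ = ∫ X in cellN (n + 1) L, ∑ S ∈ 𝒯, ∑ T ∈ 𝒯, conj (c S) * c T *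
          (conj (modeProj (n + 1) L S g X) * modeProj (n + 1) L T g X) := by
        refine integral_congr_ae (Filter.Eventually.of_forall fun X => ?_)
        dsimp only
        rw [map_sum, Finset.sum_mul_sum]
        refine Finset.sum_congr rfl fun S _ => Finset.sum_congr rfl fun T _ => ?_
        rw [map_mul]
        ring
    _ = ∑ S ∈ 𝒯, ∑ T ∈ 𝒯, ∫ X in cellN (n + 1) L, conj (c S) * c T *
          (conj (modeProj (n + 1) L S g X) * modeProj (n + 1) L T g X) := by
        rw [integral_finsetSum _ fun S _ => integrable_finsetSum _ fun T _ => hint S T]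
        exact Finset.sum_congr rfl fun S _ => integral_finsetSum _ fun T _ => hint S T
    _ = ∑ S ∈ 𝒯,
          ((‖c S‖ ^ 2 * ∫ X in cellN (n + 1) L, ‖modeProj (n + 1) L S g X‖ ^ 2 : ℝ) : ℂ) := by
        refine Finset.sum_congr rfl fun S hS => ?_
        rw [Finset.sum_eq_single_of_mem S hS fun T _ hTS => ?_]
        · rw [integral_const_mul, integral_conj_mul_self, Complex.conj_mul']
          push_cast
          ring
        · rw [integral_const_mul, integral_conj_modeProj_mul_modeProj hL (Ne.symm hTS) hg,
            mul_zero]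
    _ = ((∑ S ∈ 𝒯, ‖c S‖ ^ 2 *
          ∫ X in cellN (n + 1) L, ‖modeProj (n + 1) L S g X‖ ^ 2 : ℝ) : ℂ) := by norm_cast

/-- `∫⁻ ‖φ‖₊² = ofReal (∫ |φ|²)` on `cell^N` for continuous `φ`. [folklore] -/
theorem lintegral_nnnorm_sq_eq (φ : Config N → ℂ) (hφ : Continuous φ) :
    ∫⁻ X in cellN N L, (‖φ X‖₊ : ℝ≥0∞) ^ 2 = ENNReal.ofReal (∫ X in cellN N L, ‖φ X‖ ^ 2) := by
  -- adapted from `BECThomsonPrincipleGaussianDominationCanThetaNorm`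
  simp_rw [coe_nnnorm_sq_eq_ofReal]
  exact (ofReal_integral_eq_lintegral_ofReal (integrableOn_cellN (hφ.norm.pow 2) L)
    (Filter.Eventually.of_forall fun X => sq_nonneg ‖φ X‖)).symm

/-- **The mass of `Q_S`-components adds up**: `Σ_S ∫ |Q_S g|² = ∫ |g|²` (Pythagoras with all
`c_S = 1` and `Σ_S Q_S = 1`). [folklore] -/
theorem sum_integral_norm_sq_modeProj {n : ℕ} (hL : 0 < L) {g : Config (n + 1) → ℂ}
    (hg : Continuous g) :
    ∑ S : Finset (Fin (n + 1)), ∫ X in cellN (n + 1) L, ‖modeProj (n + 1) L S g X‖ ^ 2 =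
      ∫ X in cellN (n + 1) L, ‖g X‖ ^ 2 := by
  have h := integral_norm_sq_sum_modeProj hL Finset.univ (fun _ => (1 : ℂ)) hg
  simp only [one_mul, norm_one, one_pow] at h
  have hid : ∀ X, ∑ S : Finset (Fin (n + 1)), modeProj (n + 1) L S g X = g X := fun X => by
    have h' := congrFun (sum_modeProj (L := L) g) X
    rwa [Finset.sum_apply] at h'
  simp only [hid] at h
  exact h.symm

end Lnss

/-- **Part 1b of `stub_lnssAlgebra` (registered helper statement)**: the crux's mode projections `Q_S` are
self-adjoint on continuous functions, `∫ conj(f) Q_S g = ∫ conj(Q_S f) g` over `cell^N`. [folklore] -/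
theorem lnssAlgebra_modeProj_selfAdjoint :
    ∀ (m : ℕ) (L : ℝ) (S : Finset (Fin (m + 1)))
      (f g : Literature.MathematicalPhysics.QuantumManyBody.BoseGas.Config (m + 1) → ℂ),
      Continuous f → Continuous g →
        ∫ X in Literature.MathematicalPhysics.QuantumManyBody.BoseGas.cellN (m + 1) L, conj (f X) *
            Summit.AtomisticToContinuum.BoseEinsteinCondensation.Theorems.GaussianDominationCan.Negative.modeProj
              (m + 1) L S g X =
          ∫ X in Literature.MathematicalPhysics.QuantumManyBody.BoseGas.cellN (m + 1) L, conj
            (Summit.AtomisticToContinuum.BoseEinsteinCondensation.Theorems.GaussianDominationCan.Negative.modeProj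
              (m + 1) L S f X) * g X :=
  fun _ _ S _ _ hf hg => Lnss.integral_conj_mul_modeProj S hf hg

end Summit.AtomisticToContinuum.BoseEinsteinCondensation.Cruxes.GDTransfer.DysonDressedWitness

end
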